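import Summits.BirchSwinnertonDyer.Rank1Residual.Supersingular.X7SevenCongruenceCertificates
import HarnessLib

/-!
# `7`-congruence certificates in the kernel, reverse family: `X_E⁻(7)` (Fisher 2014, Theorem 3.9's `𝓖` with Theorem 4.8's `d₂`) and a
# kernel check of the transcription on Fisher's Example 5.3 (`162c1` and the REVERSE `7`-congruent `17334f1`)

Cell `b2b-bsdres` (run/shared/lean/b2b/bsd-rank1-residual/), supersingular family, prover A = unit `b2b-bsdres-x10b` (gen 25).  THEOREMS +
computable DEFINITIONS; no named fact introduced; nothing booked.  Companion of `X7SevenCongruenceCertificates.lean` (direct family `X_E(7)`):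
the same certificate machinery for the ANTI-symplectic family `Y_E⁻(7)` — computable mirrors `cTwistQuartic7Rev`, `cTwistCubic7Rev` of `𝓖` and `d₂`
(faithful: `toMv_cTwistQuartic7Rev`, `toMv_cTwistCubic7Rev`, PROVED), the certificate theorem `sevenCongruent_of_twistCertificate7Rev` (PROVED modulo
the named fact `thm48_sevenCongruent_twistQuartic7Rev` = Fisher Thm. 4.8 for `Y_E⁻(7)`), and ONE kernel certificate on print's own example: Fisher,
Example 5.3 — `E = 162c1`, whose reverse `7`-congruent curve `17334f1` (found there by minimising and reducing `X_E⁻(7)` and searching) is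
recovered here as the member of the family (4.8) for `(𝓖, d₂)` at the unique rational point `P = (−9 : −3 : 4)` of `X_E⁻(7)` above `j(17334f1)`
(resultant, kit j230279; `X_E(7)` has no such point), `ℚ`-isomorphic to `17334f1` by `u = 6718464/7` — so the transcription of `𝓖`, `d₂` and the
reverse fact are exercised in the kernel exactly as `𝓕`, `d₁` are by the cell's 24 census certificates (all of which are direct).  No BSD use is
made of this example (conductors `162`, `17334` are outside the residual classes); it is a transcription check with a consumer.

HONEST FRAMING (verbatim in every file of the cell): the goal of the cell is to DELETE the COMBINATION-SHAPED residual classes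
of the Birch–Swinnerton-Dyer formula for ALL analytic-rank `≤ 1` elliptic curves over `ℚ` — "full BSD formula for every rank
`≤ 1` curve in class `C`" assembled STRICTLY from published theorems — so that the rank-`≤ 1` remainder becomes exactly the
CONSTRUCTION-SHAPED classes, which are TYPED (missing-input `Prop`s), NOT attempted.  This is not "finishing BSD".

References: T. Fisher, LMS J. Comput. Math. 17 (2014) 536–564, Thm. 3.9, 4.6, 4.8, Example 5.3 [Fisher2014SevenElevenCongruent];
J. H. Silverman, AEC III §1 [SilvermanAEC2009]; Cremona's tables [Cremona2006].
-/

set_option autoImplicit false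

open MvPolynomial WeierstrassCurve
open Literature.NumberTheory.EllipticCurves.Fisher2012 (c4c6Model exists_geomTorsion_addEquiv_c4c6Model
  variableChange_shortModel_eq_c4c6Model)
open Literature.NumberTheory.EllipticCurves.Fisher2014

namespace Summit.BirchSwinnertonDyer.Rank1Residual.Supersingular

open TernaryPoly

/-! ### Computable mirrors of `𝓖` (Theorem 3.9) and `d₂` (Theorem 4.8) -/

/-- The twisted Klein quartic `𝓖` of Theorem 3.9 (`X_E⁻(7)`) as a sparse polynomial (`Δ = (c₄³ − c₆²)/1728` substituted).
[cite: Fisher2014SevenElevenCongruent, Thm. 3.9 (the quartic G)] -/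
def cTwistQuartic7Rev (c₄ c₆ : ℚ) : Poly :=
  [⟨4, 0, 0, 3⟩, ⟨3, 0, 1, c₄⟩, ⟨2, 2, 0, -(18 * c₄)⟩, ⟨2, 1, 1, -(3 * c₆)⟩, ⟨1, 3, 0, 24 * c₆⟩, ⟨1, 2, 1, 3 * c₄ ^ 2⟩,
    ⟨0, 4, 0, -(9 * c₄ ^ 2)⟩, ⟨0, 3, 1, -(c₄ * c₆)⟩, ⟨1, 0, 3, 168 * ((c₄ ^ 3 - c₆ ^ 2) / 1728)⟩,
    ⟨0, 2, 2, 1728 * ((c₄ ^ 3 - c₆ ^ 2) / 1728)⟩, ⟨0, 0, 4, 5 * c₄ * ((c₄ ^ 3 - c₆ ^ 2) / 1728)⟩]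

/-- The cubic form `d₂ = 2Δ(4x³ + c₄x²z − 12c₄xy² − 2c₆xyz + 8c₆y³ + c₄²y²z + 200Δz³)` of Theorem 4.8 as a sparse polynomial.
[cite: Fisher2014SevenElevenCongruent, Thm. 4.8 (the cubic form d₂)] -/
def cTwistCubic7Rev (c₄ c₆ : ℚ) : Poly :=
  [⟨3, 0, 0, 2 * ((c₄ ^ 3 - c₆ ^ 2) / 1728) * 4⟩, ⟨2, 0, 1, 2 * ((c₄ ^ 3 - c₆ ^ 2) / 1728) * c₄⟩,
    ⟨1, 2, 0, -(2 * ((c₄ ^ 3 - c₆ ^ 2) / 1728) * (12 * c₄))⟩, ⟨1, 1, 1, -(2 * ((c₄ ^ 3 - c₆ ^ 2) / 1728) * (2 * c₆))⟩,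
    ⟨0, 3, 0, 2 * ((c₄ ^ 3 - c₆ ^ 2) / 1728) * (8 * c₆)⟩, ⟨0, 2, 1, 2 * ((c₄ ^ 3 - c₆ ^ 2) / 1728) * c₄ ^ 2⟩,
    ⟨0, 0, 3, 2 * ((c₄ ^ 3 - c₆ ^ 2) / 1728) * (200 * ((c₄ ^ 3 - c₆ ^ 2) / 1728))⟩]

/-- A vector on `Fin 3` is `![v 0, v 1, v 2]`. [folklore] -/
private theorem vec3_eta' (v : Fin 3 → ℚ) : v = ![v 0, v 1, v 2] := by
  ext i; fin_cases i <;> rfl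

/-- `toMv (cTwistQuartic7Rev c₄ c₆) = twistQuartic7Rev c₄ c₆`. [cite: Fisher2014SevenElevenCongruent, Thm. 3.9] -/
theorem toMv_cTwistQuartic7Rev (c₄ c₆ : ℚ) : toMv (cTwistQuartic7Rev c₄ c₆) = twistQuartic7Rev c₄ c₆ := by
  apply MvPolynomial.funext
  intro v
  rw [vec3_eta' v, eval_toMv]
  simp only [TernaryPoly.eval, cTwistQuartic7Rev, twistQuartic7Rev, List.map_cons, List.map_nil, List.sum_cons, List.sum_nil,
    map_add, map_sub, map_mul, map_pow, eval_C, eval_X, Matrix.cons_val_zero, Matrix.cons_val_one, Matrix.cons_val]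
  ring

/-- `toMv (cTwistCubic7Rev c₄ c₆) = twistCubic7Rev c₄ c₆`. [cite: Fisher2014SevenElevenCongruent, Thm. 4.8] -/
theorem toMv_cTwistCubic7Rev (c₄ c₆ : ℚ) : toMv (cTwistCubic7Rev c₄ c₆) = twistCubic7Rev c₄ c₆ := by
  apply MvPolynomial.funext
  intro v
  rw [vec3_eta' v, eval_toMv]
  simp only [TernaryPoly.eval, cTwistCubic7Rev, twistCubic7Rev, List.map_cons, List.map_nil, List.sum_cons, List.sum_nil,
    map_add, map_sub, map_mul, map_pow, eval_C, eval_X, Matrix.cons_val_zero, Matrix.cons_val_one, Matrix.cons_val]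
  ring

/-- From `C • P = c4c6Model (c₄ G) (c₆ G)` and an equivariant `P[7] ≃ W[7]`, an equivariant `G[7] ≃ W[7]` (three
isomorphisms composed; copy of the private plumbing of `X7SevenCongruenceCertificates`). [folklore] -/
private theorem sevenCongruent_of_variableChange_eq_c4c6Model' (W G P : WeierstrassCurve ℚ)
    (C : VariableChange ℚ) (hC : C • P = c4c6Model G.c₄ G.c₆)
    (hP : ∃ e : geomTorsion P (7 : ℤ) ≃+ geomTorsion W (7 : ℤ),
      ∀ (σ : Field.absoluteGaloisGroup ℚ) (T : geomTorsion P (7 : ℤ)), e (σ • T) = σ • e T) :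
    ∃ e : geomTorsion G (7 : ℤ) ≃+ geomTorsion W (7 : ℤ),
      ∀ (σ : Field.absoluteGaloisGroup ℚ) (T : geomTorsion G (7 : ℤ)), e (σ • T) = σ • e T := by
  obtain ⟨e₁, he₁⟩ := hP
  obtain ⟨e₂, he₂⟩ := exists_geomTorsion_addEquiv_c4c6Model G 7
  have h₃ := P.exists_geomTorsion_addEquiv_smul C 7
  rw [hC] at h₃
  obtain ⟨e₃, he₃⟩ := h₃
  refine ⟨(e₂.trans e₃.symm).trans e₁, fun σ T => ?_⟩
  simp only [AddEquiv.trans_apply]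
  rw [← he₁]
  congr 1
  apply e₃.injective
  rw [AddEquiv.apply_symm_apply, he₃, AddEquiv.apply_symm_apply, he₂]

/-- **`7`-congruence from a kernel certificate on `X_W⁻(7)` (reverse family).**  Let `W, G` be elliptic curves over `ℚ` with
`c₄(W) = c₄ ≠ 0`, `c₆(W) = c₆ ≠ 0` (`j(W) ≠ 0, 1728`), `c₄(G) = g₄`, `c₆(G) = g₆`, and let `x y z u : ℚ`, `u ≠ 0`, satisfy —
all in exact rational arithmetic, `decide`-able — `𝓖(P) = 0` (`P = (x:y:z) ∈ X_W⁻(7)`, Fisher's Theorem 3.9 quartic `𝓖`),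
`d₂(P) ≠ 0`, `H(𝓖)(P) ≠ 0` (not a point of inflection), `c₄(𝓖)(P) = u⁴·g₄·d₂(P)²` and `c₆(𝓖)(P) = u⁶·g₆·d₂(P)³` (the member
`E_P` of the family (4.8) is `ℚ`-isomorphic to `G` by the scaling `u`).  Then `G[7] ≅ W[7]` as `Γ_ℚ`-modules.  PROVED modulo
Fisher's Theorem 4.8 (`n = 7`, `Y_E⁻(7)`) = the named fact `thm48_sevenCongruent_twistQuartic7Rev`; the evaluation of the
covariants is `eval_kleinH_eq` / `eval_kleinC4_eq` / `eval_kleinC6_eq`, the scaling step is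
`variableChange_shortModel_eq_c4c6Model`. [cite: Fisher2014SevenElevenCongruent, Thm. 4.8 with Thm. 4.6 and Thm. 3.9] -/
theorem sevenCongruent_of_twistCertificate7Rev (hF : thm48_sevenCongruent_twistQuartic7Rev)
    (W G : WeierstrassCurve ℚ) [W.IsElliptic] [G.IsElliptic] (c₄ c₆ g₄ g₆ x y z u : ℚ)
    (hW4 : W.c₄ = c₄) (hW6 : W.c₆ = c₆) (hG4 : G.c₄ = g₄) (hG6 : G.c₆ = g₆) (h0 : c₄ ≠ 0) (h1728 : c₆ ≠ 0) (hu : u ≠ 0)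
    (hP : TernaryPoly.eval x y z (cTwistQuartic7Rev c₄ c₆) = 0)
    (hd : TernaryPoly.eval x y z (cTwistCubic7Rev c₄ c₆) ≠ 0)
    (hH : hAt x y z (cTwistQuartic7Rev c₄ c₆) ≠ 0)
    (h4 : c4At x y z (cTwistQuartic7Rev c₄ c₆) = u ^ 4 * g₄ * TernaryPoly.eval x y z (cTwistCubic7Rev c₄ c₆) ^ 2)
    (h6 : c6At x y z (cTwistQuartic7Rev c₄ c₆) = u ^ 6 * g₆ * TernaryPoly.eval x y z (cTwistCubic7Rev c₄ c₆) ^ 3) :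
    ∃ e : geomTorsion G (7 : ℤ) ≃+ geomTorsion W (7 : ℤ),
      ∀ (σ : Field.absoluteGaloisGroup ℚ) (T : geomTorsion G (7 : ℤ)), e (σ • T) = σ • e T := by
  -- translate the kernel quantities into `MvPolynomial.eval` of Fisher's objects
  have eP : MvPolynomial.eval ![x, y, z] (twistQuartic7Rev W.c₄ W.c₆) = 0 := by
    rw [hW4, hW6, ← toMv_cTwistQuartic7Rev, eval_toMv, hP]
  have ed : MvPolynomial.eval ![x, y, z] (twistCubic7Rev W.c₄ W.c₆) = TernaryPoly.eval x y z (cTwistCubic7Rev c₄ c₆) := by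
    rw [hW4, hW6, ← toMv_cTwistCubic7Rev, eval_toMv]
  have eH : MvPolynomial.eval ![x, y, z] (kleinH (twistQuartic7Rev W.c₄ W.c₆)) ≠ 0 := by
    rw [hW4, hW6, ← toMv_cTwistQuartic7Rev, eval_kleinH_eq]; exact hH
  have e4 : MvPolynomial.eval ![x, y, z] (kleinC4 (twistQuartic7Rev W.c₄ W.c₆)) =
      u ^ 4 * G.c₄ * TernaryPoly.eval x y z (cTwistCubic7Rev c₄ c₆) ^ 2 := by
    rw [hW4, hW6, ← toMv_cTwistQuartic7Rev, eval_kleinC4_eq, h4, hG4]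
  have e6 : MvPolynomial.eval ![x, y, z] (kleinC6 (twistQuartic7Rev W.c₄ W.c₆)) =
      u ^ 6 * G.c₆ * TernaryPoly.eval x y z (cTwistCubic7Rev c₄ c₆) ^ 3 := by
    rw [hW4, hW6, ← toMv_cTwistQuartic7Rev, eval_kleinC6_eq, h6, hG6]
  -- the member E_P and its identification with G
  have hA4 : -27 * (MvPolynomial.eval ![x, y, z] (kleinC4 (twistQuartic7Rev W.c₄ W.c₆)) /
      MvPolynomial.eval ![x, y, z] (twistCubic7Rev W.c₄ W.c₆) ^ 2) = -27 * (u ^ 4 * G.c₄) := by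
    rw [e4, ed]; field_simp
  have hA6 : -54 * (MvPolynomial.eval ![x, y, z] (kleinC6 (twistQuartic7Rev W.c₄ W.c₆)) /
      MvPolynomial.eval ![x, y, z] (twistCubic7Rev W.c₄ W.c₆) ^ 3) = -54 * (u ^ 6 * G.c₆) := by
    rw [e6, ed]; field_simp
  have hC : (⟨Units.mk0 u hu, 0, 0, 0⟩ : VariableChange ℚ) • twistMember7Rev W.c₄ W.c₆ x y z = c4c6Model G.c₄ G.c₆ := by
    rw [twistMember7Rev]
    exact variableChange_shortModel_eq_c4c6Model G _ _ u hu hA4 hA6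
  haveI : (twistMember7Rev W.c₄ W.c₆ x y z).IsElliptic := by
    rw [← inv_smul_smul (⟨Units.mk0 u hu, 0, 0, 0⟩ : VariableChange ℚ) (twistMember7Rev W.c₄ W.c₆ x y z), hC]
    infer_instance
  have hd' : MvPolynomial.eval ![x, y, z] (twistCubic7Rev W.c₄ W.c₆) ≠ 0 := by rw [ed]; exact hd
  exact sevenCongruent_of_variableChange_eq_c4c6Model' W G _ _ hC
    (sevenCongruent_twistMember7Rev hF W x y z (hW4 ▸ h0) (hW6 ▸ h1728) eP hd' eH)

/-! ### Kernel check on Fisher's Example 5.3 -/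

/-- **`17334f1[7] ≅ 162c1[7]`** (`Γ_ℚ`-modules; print: REVERSE `7`-congruent, Fisher 2014 Example 5.3, found there as the point `P₄` of the
minimised-reduced `X_E⁻(7)`), from the point `P = (−9 : −3 : 4)` of `X_E⁻(7) = {𝓖 = 0}` in Theorem 3.9's coordinates (`E = 162c1`, `c₄ = −135`,
`c₆ = 243`), scaling `u = 6718464/7`; partner `17334f1` (`c₄ = 262750905`, `c₆ = 4283333278803`).  Kernel certificate (`decide +kernel`) through
`sevenCongruent_of_twistCertificate7Rev`; conditional only on Fisher's Theorem 4.8 (`Y_E⁻(7)`).  Point by resultant, kit j230279 (the other curves of the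
example, `162c2` and `624186*`, are likewise points of `X_E⁻(7)`; the direct one, `293706x2`, a point of `X_E(7)`).  A transcription check with a
consumer; no BSD use. [cite: Fisher2014SevenElevenCongruent, Example 5.3 with Thm. 4.8] [cite: Cremona2006, Table 1 (Cremona labels 162c1, 17334f1)] -/
theorem sevenCongruent_rev_162c1_17334f1_7 (hF : thm48_sevenCongruent_twistQuartic7Rev)
    {W F : WeierstrassCurve ℚ} [W.IsElliptic] [F.IsElliptic]
    (hWeq : W = ⟨1, -1, 0, 3, -1⟩) (hFeq : F = ⟨1, -1, 0, -5473977, -4956193171⟩) :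
    ∃ e : geomTorsion F (7 : ℤ) ≃+ geomTorsion W (7 : ℤ),
      ∀ (σ : Field.absoluteGaloisGroup ℚ) (T : geomTorsion F (7 : ℤ)), e (σ • T) = σ • e T := by
  refine sevenCongruent_of_twistCertificate7Rev hF W F (-135) 243 262750905 4283333278803
    (-9) (-3) 4 (6718464 / 7 : ℚ) ?_ ?_ ?_ ?_ (by norm_num) (by norm_num) (by norm_num)
    (by decide +kernel) (by decide +kernel) (by decide +kernel) (by decide +kernel) (by decide +kernel)
  · subst hWeq; norm_num [WeierstrassCurve.c₄, WeierstrassCurve.b₂, WeierstrassCurve.b₄]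
  · subst hWeq; norm_num [WeierstrassCurve.c₆, WeierstrassCurve.b₂, WeierstrassCurve.b₄, WeierstrassCurve.b₆]
  · subst hFeq; norm_num [WeierstrassCurve.c₄, WeierstrassCurve.b₂, WeierstrassCurve.b₄]
  · subst hFeq; norm_num [WeierstrassCurve.c₆, WeierstrassCurve.b₂, WeierstrassCurve.b₄, WeierstrassCurve.b₆]

end Summit.BirchSwinnertonDyer.Rank1Residual.Supersingular
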